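import Mathlib
import Summits.NavierStokesRegularity.NavierStokesRegularity.Theorems.LerayQuarterDissipationFiniteDissipationLiouvilleWindowRecurrenceStretching
import Summits.NavierStokesRegularity.NavierStokesRegularity.Theorems.LerayQuarterDissipationFiniteDissipationLiouvilleCriticalProductionLawApex
import HarnessLib

/-!
# Crux `FiniteDissipationLiouville` (stmt-NavierStokesRegularity-22144): THE VORTEX-STRETCHING EXCESS
# AND THE SUPER-CALORIC ENSTROPHY DENSITY RECUR WITH BOUNDED GAPS AND FILL A DEFINITE VOLUME

Theorems file of route `LerayQuarterDissipation` (lead prover g19; `--supports` the crux; third set of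
instances of `…WindowSocket`, after `…WindowRecurrence` and `…WindowRecurrenceStretching`, whose
jet-continuity tools are reused). Navier–Stokes regularity is NOT proved by
anything here; no summit is.

Two more apex criteria of lead g18 go through the window socket — the stretching form in
`…WindowRecurrenceStretching`; this file: the critical-production rows in the crux's own frame:

* the STRETCHING-FORM local enstrophy balance `⟪ω, ∇u ω⟫ ≤ |∇ω|²_F + ‖ω‖²/(4(−t))` on the enveloped
  class (`…LocalBalance.not_singular_of_stretchingBalance_near_apex`): **`stretching_excess_in_every_window`**
  (∃ ε(A) ∈ (0,1): every singular enveloped member has in every window `[−c², −εc²]` a point where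
  vortex stretching beats local palinstrophy plus the scaling quarter, `|∇ω|²_F + ‖ω‖²/(4(−t)) < ⟪ω, ∇u ω⟫`)
  and **`stretching_excess_volume`** (∃ ε(A), η(A) > 0: the excess set meets `[−1,−ε] × ℝ³` in volume `≥ η`);
* the CRITICAL-PRODUCTION rows in the crux's own frame (KNSS-gauge Type-I + the dissipation law, NO
  envelope): with a palinstrophy credit `a < 1` (`…CriticalProduction.not_singular_of_critProdCredit_near_apex`)
  — **`critProd_excess_in_every_window`** / **`critProd_excess_volume`** (∃ ε(C,K,a), η(C,K,a): in every
  window a point, indeed a set of definite volume, where `‖ω‖² < (−t)(⟪ω, ∇u ω⟫ − a|∇ω|²_F)`); and the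
  BORDERLINE `a = 1` (`…CriticalProduction.not_singular_of_enstrophy_subsolution_near_apex`, lead g18's
  T59) — **`superCaloric_in_every_window`** / **`superCaloric_volume`**: for every singular member of
  `𝒟_{C,K}` the scale-invariant enstrophy density `t²‖ω‖²` is STRICTLY SUPER-CALORIC,
  `‖ω‖² < (−t)(⟪ω, ∇u ω⟫ − |∇ω|²_F)` (i.e. `(∂ₜ + u·∇ − Δ)(t²‖ω‖²) > 0`), on a set of definite volume
  in EVERY backward window — bounded gaps in log-time, every scale.

Bookkeeping: pointwise scale covariance (`stretchingBalance_at_nsRescale`, `critProd_at_nsRescale`),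
convergence of the second-order jet `(ω, ∇u ω, ∇ω)` at a point along KNSS limits
(`tendsto_clm_apply_of_tendsto`, `…EndpointScheme.tendsto_fderiv_curl_of_unif`), violations pass to the
approximants, violation sets are open (joint continuity of `∇u`, `∇ω` on the open past).

HONEST FRAMING. Compactness corollaries (ineffective constants) of g18's apex criteria, about a
HYPOTHETICAL singular profile; the borderline clause is a necessary condition on every singular
member of the stratum `𝒟` (in particular on the critical element of the crux). Nothing is removed
from the DSS wall (`∀ c>1 TypeIDSSLiouville c`, NECESSARY for the crux). Nothing here bears on NS
regularity.

References: Koch–Nadirashvili–Seregin–Šverák, Acta Math. 203 (2009) §4; folklore.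
-/

noncomputable section

set_option linter.dupNamespace false

namespace Summit.NavierStokesRegularity.NavierStokesRegularity.Theorems.FiniteDissipationLiouville.WindowRecurrence

open MeasureTheory Set Filter Topology Metric InnerProductSpace Function Real
open scoped RealInnerProductSpace ContDiff ENNReal
open Literature.Analysis Literature.Analysis.FluidPDE
open Summit.NavierStokesRegularity.ForcedUniquenessCountableJunk (frobeniusNormSq_smul)
open Summit.NavierStokesRegularity.NavierStokesRegularity.Theorems
open Summit.NavierStokesRegularity.NavierStokesRegularity.Theorems.RecurrentReductionD
open Summit.NavierStokesRegularity.NavierStokesRegularity.Theorems.FiniteDissipationLiouville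
open Summit.NavierStokesRegularity.NavierStokesRegularity.Theorems.FiniteDissipationLiouville.CrossFlow
open Summit.NavierStokesRegularity.NavierStokesRegularity.Theorems.FiniteDissipationLiouville.EndpointScheme
open Summit.NavierStokesRegularity.NavierStokesRegularity.Theorems.FiniteDissipationLiouville.LambProduct
open Summit.NavierStokesRegularity.NavierStokesRegularity.Theorems.FiniteDissipationLiouville.LocalBalance
open Summit.NavierStokesRegularity.NavierStokesRegularity.Theorems.FiniteDissipationLiouville.CriticalProduction
open Summit.NavierStokesRegularity.NavierStokesRegularity.Theorems.FiniteDissipationLiouville.WindowSocket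

variable {C : ℝ} {V : ℝ → EuclideanSpace ℝ (Fin 3) → EuclideanSpace ℝ (Fin 3)}

/-! ### Critical production with a palinstrophy credit, and the super-caloric enstrophy density -/

section CriticalProduction

/-- **Pointwise scale covariance of the critical-production bound with credit `a`.** [folklore] -/
theorem critProd_at_nsRescale (V : ℝ → EuclideanSpace ℝ (Fin 3) → EuclideanSpace ℝ (Fin 3))
    (a : ℝ) {c s : ℝ} (y : EuclideanSpace ℝ (Fin 3)) (hc : 0 < c)
    (h : (-(c ^ 2 * s)) * (⟪curl (V (c ^ 2 * s)) (c • y), fderiv ℝ (V (c ^ 2 * s)) (c • y)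
        (curl (V (c ^ 2 * s)) (c • y))⟫
        - a * frobeniusNormSq (fderiv ℝ (curl (V (c ^ 2 * s))) (c • y))) ≤
      ⟪curl (V (c ^ 2 * s)) (c • y), curl (V (c ^ 2 * s)) (c • y)⟫) :
    (-s) * (⟪curl (nsRescale c V s) y, fderiv ℝ (nsRescale c V s) y (curl (nsRescale c V s) y)⟫
        - a * frobeniusNormSq (fderiv ℝ (curl (nsRescale c V s)) y)) ≤
      ⟪curl (nsRescale c V s) y, curl (nsRescale c V s) y⟫ := by
  have hcurl : curl (nsRescale c V s) y = (c * c) • curl (V (c ^ 2 * s)) (c • y) := by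
    rw [curl_eq_curlCLM, fderiv_nsRescale, map_smul, ← curl_eq_curlCLM]
  rw [hcurl, fderiv_nsRescale, fderiv_curl_nsRescale, frobeniusNormSq_smul,
    _root_.smul_apply, map_smul, real_inner_smul_left, real_inner_smul_right, real_inner_smul_right,
    real_inner_smul_left, real_inner_smul_right]
  set P : ℝ := ⟪curl (V (c ^ 2 * s)) (c • y), fderiv ℝ (V (c ^ 2 * s)) (c • y)
    (curl (V (c ^ 2 * s)) (c • y))⟫ with hP
  set F : ℝ := frobeniusNormSq (fderiv ℝ (curl (V (c ^ 2 * s))) (c • y)) with hF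
  set Q : ℝ := ⟪curl (V (c ^ 2 * s)) (c • y), curl (V (c ^ 2 * s)) (c • y)⟫ with hQ
  have hc4 : 0 ≤ c ^ 4 := by positivity
  have key := mul_le_mul_of_nonneg_left h hc4
  calc (-s) * (c * c * (c * c * (c * c * P)) - a * ((c * c * c) ^ 2 * F))
      = c ^ 4 * ((-(c ^ 2 * s)) * (P - a * F)) := by ring
    _ ≤ c ^ 4 * Q := key
    _ = c * c * (c * c * Q) := by ring

/-- **Violations of the critical-production bound pass from KNSS limits to the approximants.**
[cite: KochNadirashviliSereginSverak2009, Prop. 4.1 (arXiv:0709.3599 p. 8)] -/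
theorem critProd_violation_eventually {v : ℕ → ℝ → EuclideanSpace ℝ (Fin 3) → EuclideanSpace ℝ (Fin 3)}
    {W : ℝ → EuclideanSpace ℝ (Fin 3) → EuclideanSpace ℝ (Fin 3)}
    (hv : ∀ j, IsTypeIAncientMild C (v j)) (hW : IsTypeIAncientMild C W)
    (hunif : ∀ n : ℕ, TendstoUniformlyOn (fun j z => v j z.1 z.2) (fun z => W z.1 z.2) atTop
      (Icc (-((n : ℝ) + 2)) (-(1 / ((n : ℝ) + 2))) ×ˢ
        closedBall (0 : EuclideanSpace ℝ (Fin 3)) ((n : ℝ) + 2)))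
    (hgr : ∀ t < 0, ∀ x, Tendsto (fun j => fderiv ℝ (v j t) x) atTop (𝓝 (fderiv ℝ (W t) x)))
    (a : ℝ) {s : ℝ} (hs : s < 0) (y : EuclideanSpace ℝ (Fin 3))
    (hbad : ¬ (-s) * (⟪curl (W s) y, fderiv ℝ (W s) y (curl (W s) y)⟫
        - a * frobeniusNormSq (fderiv ℝ (curl (W s)) y)) ≤ ⟪curl (W s) y, curl (W s) y⟫) :
    ∀ᶠ j in atTop, ¬ (-s) * (⟪curl (v j s) y, fderiv ℝ (v j s) y (curl (v j s) y)⟫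
        - a * frobeniusNormSq (fderiv ℝ (curl (v j s)) y)) ≤ ⟪curl (v j s) y, curl (v j s) y⟫ := by
  have htb : Tendsto (fun j => curl (v j s) y) atTop (𝓝 (curl (W s) y)) :=
    tendsto_curl_of_fderiv (hgr s hs y)
  have htG : Tendsto (fun j => fderiv ℝ (curl (v j s)) y) atTop (𝓝 (fderiv ℝ (curl (W s)) y)) :=
    tendsto_fderiv_curl_of_unif hv hW hunif hs y
  have hLb : Tendsto (fun j => fderiv ℝ (v j s) y (curl (v j s) y)) atTop
      (𝓝 (fderiv ℝ (W s) y (curl (W s) y))) := tendsto_clm_apply_of_tendsto (hgr s hs y) htb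
  have hL : Tendsto (fun j => (-s) * (⟪curl (v j s) y, fderiv ℝ (v j s) y (curl (v j s) y)⟫
      - a * frobeniusNormSq (fderiv ℝ (curl (v j s)) y))) atTop
      (𝓝 ((-s) * (⟪curl (W s) y, fderiv ℝ (W s) y (curl (W s) y)⟫
        - a * frobeniusNormSq (fderiv ℝ (curl (W s)) y)))) :=
    ((htb.inner hLb).sub (((continuous_frobeniusNormSq'.tendsto _).comp htG).const_mul a)).const_mul _
  have hR : Tendsto (fun j => ⟪curl (v j s) y, curl (v j s) y⟫) atTop
      (𝓝 ⟪curl (W s) y, curl (W s) y⟫) := htb.inner htb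
  rw [not_le] at hbad
  filter_upwards [hR.eventually_lt hL hbad] with j hj
  exact not_le.2 hj

/-- **The violation set of the critical-production bound is open.** [folklore] -/
theorem isOpen_critProd_violation (hV : IsTypeIAncientMild C V) (a : ℝ) :
    IsOpen {p : ℝ × EuclideanSpace ℝ (Fin 3) | p.1 < 0 ∧
      ¬ (-p.1) * (⟪curl (V p.1) p.2, fderiv ℝ (V p.1) p.2 (curl (V p.1) p.2)⟫
          - a * frobeniusNormSq (fderiv ℝ (curl (V p.1)) p.2)) ≤
        ⟪curl (V p.1) p.2, curl (V p.1) p.2⟫} := by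
  have hS : IsOpen (Iio (0:ℝ) ×ˢ (univ : Set (EuclideanSpace ℝ (Fin 3)))) :=
    isOpen_Iio.prod isOpen_univ
  have hb := continuousOn_curl hV
  have hD := continuousOn_fderiv hV
  have hG := continuousOn_fderiv_curl hV
  have hL : ContinuousOn (fun p : ℝ × EuclideanSpace ℝ (Fin 3) =>
      (-p.1) * (⟪curl (V p.1) p.2, fderiv ℝ (V p.1) p.2 (curl (V p.1) p.2)⟫
        - a * frobeniusNormSq (fderiv ℝ (curl (V p.1)) p.2))) (Iio 0 ×ˢ univ) :=
    continuous_fst.neg.continuousOn.mul ((hb.inner (continuousOn_clm_apply hD hb)).sub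
      ((continuous_frobeniusNormSq'.comp_continuousOn hG).const_smul a))
  have hR : ContinuousOn (fun p : ℝ × EuclideanSpace ℝ (Fin 3) =>
      ⟪curl (V p.1) p.2, curl (V p.1) p.2⟫) (Iio 0 ×ˢ univ) := hb.inner hb
  have hO := (hL.sub hR).isOpen_inter_preimage hS (isOpen_Ioi (a := (0:ℝ)))
  convert hO using 1
  ext p
  simp only [mem_setOf_eq, mem_inter_iff, mem_prod, mem_Iio, mem_univ, and_true, mem_preimage,
    mem_Ioi, Pi.sub_apply, sub_pos, not_le]

/-- **THE CRITICAL-PRODUCTION EXCESS (credit `a < 1`) RECURS WITH BOUNDED GAPS — crux frame, no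
envelope.** For all `C, K` and `a < 1` there is `ε ∈ (0,1)` such that every SINGULAR member of
`𝒟_{C,K}` (`IsTypeIAncientMild C V` + the dissipation law with constant `K`) has in every window
`[−c², −εc²]`, `c > 0`, a point with `‖ω‖² < (−t)(⟪ω, ∇V ω⟫ − a|∇ω|²_F)`.
[parabolic strong maximum principle + KNSS compactness; cite: KochNadirashviliSereginSverak2009, §4 (arXiv:0709.3599 p. 8)] -/
theorem critProd_excess_in_every_window {a : ℝ} (ha : a < 1) (C K : ℝ) : ∃ ε : ℝ, 0 < ε ∧ ε < 1 ∧
    ∀ (V : ℝ → EuclideanSpace ℝ (Fin 3) → EuclideanSpace ℝ (Fin 3)), IsTypeIAncientMild C V →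
      (∀ s : ℝ, s < 0 → ∫⁻ x, ‖fderiv ℝ (V s) x‖ₑ ^ 2 ≤ ENNReal.ofReal (K / Real.sqrt (-s))) →
      (∀ r > 0, ∀ M : ℝ, ∃ t ∈ Ioo (-(r ^ 2)) (0 : ℝ),
        ∃ x ∈ ball (0 : EuclideanSpace ℝ (Fin 3)) r, M < ‖V t x‖) →
      ∀ c : ℝ, 0 < c → ∃ s ∈ Icc (-c ^ 2) (-(ε * c ^ 2)), ∃ y : EuclideanSpace ℝ (Fin 3),
        ⟪curl (V s) y, curl (V s) y⟫ < (-s) * (⟪curl (V s) y, fderiv ℝ (V s) y (curl (V s) y)⟫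
          - a * frobeniusNormSq (fderiv ℝ (curl (V s)) y)) := by
  obtain ⟨ε, hε, hε1, h⟩ := exists_window_of_apex_kill (C := C) (K := K) (Q := fun _ => True)
    (G := fun F s y => (-s) * (⟪curl (F s) y, fderiv ℝ (F s) y (curl (F s) y)⟫
        - a * frobeniusNormSq (fderiv ℝ (curl (F s)) y)) ≤ ⟪curl (F s) y, curl (F s) y⟫)
    (fun _ _ _ _ => trivial) (fun _ _ _ _ _ _ _ _ => trivial)
    (fun F c s y hc _ hG => critProd_at_nsRescale F a y hc hG)
    (fun u W hu hW hunif hpt hgr s hs y hbad => critProd_violation_eventually hu hW hunif hgr a hs y hbad)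
    (fun W hW hlawW _ hG => not_singular_of_critProdCredit_near_apex ha hW hlawW (τ := -1/2)
      (by norm_num) fun s h1 h2 y => hG s (by linarith) h2 y)
  refine ⟨ε, hε, hε1, fun V hV hlaw hsing c hc => ?_⟩
  obtain ⟨s, hs, y, hy⟩ := h V hV hlaw trivial hsing c hc
  exact ⟨s, hs, y, not_le.1 hy⟩

/-- **THE CRITICAL-PRODUCTION EXCESS FILLS A DEFINITE VOLUME (crux frame).** For all `C, K`, `a < 1`
there are `ε ∈ (0,1)`, `η > 0` with: for every singular member of `𝒟_{C,K}` the set of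
`(s,y) ∈ [−1,−ε] × ℝ³` with `‖ω‖² < (−s)(⟪ω, ∇V ω⟫ − a|∇ω|²_F)` has volume `≥ η`.
[parabolic strong maximum principle + KNSS compactness; cite: KochNadirashviliSereginSverak2009, §4 (arXiv:0709.3599 p. 8)] -/
theorem critProd_excess_volume {a : ℝ} (ha : a < 1) (C K : ℝ) : ∃ ε : ℝ, 0 < ε ∧ ε < 1 ∧
    ∃ η : ℝ, 0 < η ∧
    ∀ (V : ℝ → EuclideanSpace ℝ (Fin 3) → EuclideanSpace ℝ (Fin 3)), IsTypeIAncientMild C V →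
      (∀ s : ℝ, s < 0 → ∫⁻ x, ‖fderiv ℝ (V s) x‖ₑ ^ 2 ≤ ENNReal.ofReal (K / Real.sqrt (-s))) →
      (∀ r > 0, ∀ M : ℝ, ∃ t ∈ Ioo (-(r ^ 2)) (0 : ℝ),
        ∃ x ∈ ball (0 : EuclideanSpace ℝ (Fin 3)) r, M < ‖V t x‖) →
      ENNReal.ofReal η ≤ volume {p : ℝ × EuclideanSpace ℝ (Fin 3) | p.1 ∈ Icc (-1 : ℝ) (-ε) ∧
        ⟪curl (V p.1) p.2, curl (V p.1) p.2⟫ < (-p.1) * (⟪curl (V p.1) p.2,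
          fderiv ℝ (V p.1) p.2 (curl (V p.1) p.2)⟫ - a * frobeniusNormSq (fderiv ℝ (curl (V p.1)) p.2))} := by
  obtain ⟨ε, hε, hε1, η, hη, h⟩ := exists_window_volume_of_apex_kill (C := C) (K := K)
    (Q := fun _ => True)
    (G := fun F s y => (-s) * (⟪curl (F s) y, fderiv ℝ (F s) y (curl (F s) y)⟫
        - a * frobeniusNormSq (fderiv ℝ (curl (F s)) y)) ≤ ⟪curl (F s) y, curl (F s) y⟫)
    (fun _ _ _ _ _ _ _ _ => trivial)
    (fun u W hu hW hunif hpt hgr s hs y hbad => critProd_violation_eventually hu hW hunif hgr a hs y hbad)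
    (fun U hU _ => isOpen_critProd_violation hU a)
    (fun W hW hlawW _ hG => not_singular_of_critProdCredit_near_apex ha hW hlawW (τ := -1/2)
      (by norm_num) fun s h1 h2 y => hG s (by linarith) h2 y)
  refine ⟨ε, hε, hε1, η, hη, fun V hV hlaw hsing => ?_⟩
  exact (h V hV hlaw trivial hsing).trans (measure_mono fun p hp => ⟨hp.1, not_le.1 hp.2⟩)

/-- **THE ENSTROPHY DENSITY `t²‖ω‖²` OF A SINGULAR MEMBER OF THE STRATUM IS STRICTLY SUPER-CALORIC IN
EVERY WINDOW (borderline `a = 1`, crux frame).** For all `C, K` there is `ε ∈ (0,1)` such that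
every singular member of `𝒟_{C,K}` has in every window `[−c², −εc²]` a point with
`‖ω‖² < (−t)(⟪ω, ∇V ω⟫ − |∇ω|²_F)`, i.e. `(∂ₜ + V·∇ − Δ)(t²‖ω‖²) > 0` there.
[parabolic strong maximum principle + KNSS compactness; cite: KochNadirashviliSereginSverak2009, §4 (arXiv:0709.3599 p. 8)] -/
theorem superCaloric_in_every_window (C K : ℝ) : ∃ ε : ℝ, 0 < ε ∧ ε < 1 ∧
    ∀ (V : ℝ → EuclideanSpace ℝ (Fin 3) → EuclideanSpace ℝ (Fin 3)), IsTypeIAncientMild C V →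
      (∀ s : ℝ, s < 0 → ∫⁻ x, ‖fderiv ℝ (V s) x‖ₑ ^ 2 ≤ ENNReal.ofReal (K / Real.sqrt (-s))) →
      (∀ r > 0, ∀ M : ℝ, ∃ t ∈ Ioo (-(r ^ 2)) (0 : ℝ),
        ∃ x ∈ ball (0 : EuclideanSpace ℝ (Fin 3)) r, M < ‖V t x‖) →
      ∀ c : ℝ, 0 < c → ∃ s ∈ Icc (-c ^ 2) (-(ε * c ^ 2)), ∃ y : EuclideanSpace ℝ (Fin 3),
        ⟪curl (V s) y, curl (V s) y⟫ < (-s) * (⟪curl (V s) y, fderiv ℝ (V s) y (curl (V s) y)⟫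
          - frobeniusNormSq (fderiv ℝ (curl (V s)) y)) := by
  obtain ⟨ε, hε, hε1, h⟩ := exists_window_of_apex_kill (C := C) (K := K) (Q := fun _ => True)
    (G := fun F s y => (-s) * (⟪curl (F s) y, fderiv ℝ (F s) y (curl (F s) y)⟫
        - 1 * frobeniusNormSq (fderiv ℝ (curl (F s)) y)) ≤ ⟪curl (F s) y, curl (F s) y⟫)
    (fun _ _ _ _ => trivial) (fun _ _ _ _ _ _ _ _ => trivial)
    (fun F c s y hc _ hG => critProd_at_nsRescale F 1 y hc hG)
    (fun u W hu hW hunif hpt hgr s hs y hbad => critProd_violation_eventually hu hW hunif hgr 1 hs y hbad)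
    (fun W hW hlawW _ hG => not_singular_of_enstrophy_subsolution_near_apex hW hlawW (τ := -1/2)
      (by norm_num) fun s h1 h2 y => by
        have := hG s (by linarith) h2 y
        rwa [one_mul] at this)
  refine ⟨ε, hε, hε1, fun V hV hlaw hsing c hc => ?_⟩
  obtain ⟨s, hs, y, hy⟩ := h V hV hlaw trivial hsing c hc
  refine ⟨s, hs, y, ?_⟩
  have := not_le.1 hy
  rwa [one_mul] at this

/-- **THE SUPER-CALORIC SET OF `t²‖ω‖²` HAS DEFINITE VOLUME IN EVERY WINDOW (crux frame).** For all
`C, K` there are `ε ∈ (0,1)`, `η > 0` with: for every singular member of `𝒟_{C,K}` the set of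
`(s,y) ∈ [−1,−ε] × ℝ³` with `‖ω‖² < (−s)(⟪ω, ∇V ω⟫ − |∇ω|²_F)` has volume `≥ η`.
[parabolic strong maximum principle + KNSS compactness; cite: KochNadirashviliSereginSverak2009, §4 (arXiv:0709.3599 p. 8)] -/
theorem superCaloric_volume (C K : ℝ) : ∃ ε : ℝ, 0 < ε ∧ ε < 1 ∧ ∃ η : ℝ, 0 < η ∧
    ∀ (V : ℝ → EuclideanSpace ℝ (Fin 3) → EuclideanSpace ℝ (Fin 3)), IsTypeIAncientMild C V →
      (∀ s : ℝ, s < 0 → ∫⁻ x, ‖fderiv ℝ (V s) x‖ₑ ^ 2 ≤ ENNReal.ofReal (K / Real.sqrt (-s))) →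
      (∀ r > 0, ∀ M : ℝ, ∃ t ∈ Ioo (-(r ^ 2)) (0 : ℝ),
        ∃ x ∈ ball (0 : EuclideanSpace ℝ (Fin 3)) r, M < ‖V t x‖) →
      ENNReal.ofReal η ≤ volume {p : ℝ × EuclideanSpace ℝ (Fin 3) | p.1 ∈ Icc (-1 : ℝ) (-ε) ∧
        ⟪curl (V p.1) p.2, curl (V p.1) p.2⟫ < (-p.1) * (⟪curl (V p.1) p.2,
          fderiv ℝ (V p.1) p.2 (curl (V p.1) p.2)⟫ - frobeniusNormSq (fderiv ℝ (curl (V p.1)) p.2))} := by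
  obtain ⟨ε, hε, hε1, η, hη, h⟩ := exists_window_volume_of_apex_kill (C := C) (K := K)
    (Q := fun _ => True)
    (G := fun F s y => (-s) * (⟪curl (F s) y, fderiv ℝ (F s) y (curl (F s) y)⟫
        - 1 * frobeniusNormSq (fderiv ℝ (curl (F s)) y)) ≤ ⟪curl (F s) y, curl (F s) y⟫)
    (fun _ _ _ _ _ _ _ _ => trivial)
    (fun u W hu hW hunif hpt hgr s hs y hbad => critProd_violation_eventually hu hW hunif hgr 1 hs y hbad)
    (fun U hU _ => isOpen_critProd_violation hU 1)
    (fun W hW hlawW _ hG => not_singular_of_enstrophy_subsolution_near_apex hW hlawW (τ := -1/2)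
      (by norm_num) fun s h1 h2 y => by
        have := hG s (by linarith) h2 y
        rwa [one_mul] at this)
  refine ⟨ε, hε, hε1, η, hη, fun V hV hlaw hsing => ?_⟩
  refine (h V hV hlaw trivial hsing).trans (measure_mono fun p hp => ⟨hp.1, ?_⟩)
  have := hp.2
  rw [one_mul] at this
  exact not_le.1 this

end CriticalProduction

end Summit.NavierStokesRegularity.NavierStokesRegularity.Theorems.FiniteDissipationLiouville.WindowRecurrence

end
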